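import Summits.AtomisticToContinuum.Crystallization.Theses.BrittleRungDescent
import Summits.AtomisticToContinuum.Crystallization.Theorems.BrittleRungDescentLJKissingBalls

/-!
# `Assembly` — glue for route `BrittleRungDescent`
(item `stmt-AtomisticToContinuum-9215`, rev 0; since rev 5 item `stmt-AtomisticToContinuum-15633`)

The rev-0 assembly item of the route was the implication chain
`LocalHalesKernel → LJBondSpread → LJKissingBalls → LJBarlowRigidity → Crystallization`.
It is pure logic: `LJKissingBalls` is by definition the bookkeeping implication
`LocalHalesKernel → LJBondSpread → H`, where `H` is literally the hypothesis of `LJBarlowRigidity`,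
and `LJBarlowRigidity` is `H → Crystallization`; so the proof was `hR (hglue hG hK)`, exactly as
the route's deciding theorem `closes` composes the items.  Nothing analytic happens here; the
content lives in the cruxes.

**Repair 2026-08-16 (route rev 5 of 15:47Z).** The route restated its assembly UNDER THE SAME DECL
NAME `Assembly` as the 3-ary `LocalHalesKernel → LJBondSpread → LJBarlowRigidity → Crystallization`
(item `stmt-AtomisticToContinuum-15633`; the glue `LJKissingBalls`, item
`stmt-AtomisticToContinuum-9211`, is PROVED: `Theorems.LJKissingBalls_proof` in
`Theorems/BrittleRungDescentLJKissingBalls.lean`, and was discharged from the hypotheses), so the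
4-ary proof `intro hG hK hglue hR; exact hR (hglue hG hK)` of the theorem below stopped
elaborating.  The theorem keeps its name (Theorems files keep their declarations) and now proves
the current `Assembly` by `hR (LJKissingBalls_proof hG hK)`, closing the rev-5 item
`stmt-AtomisticToContinuum-15633` (precedent for such a same-name repair:
`PneNP/Theorems/ExpanderLinearGeneratorsAssembly.lean`).
-/

namespace Summit.AtomisticToContinuum.Crystallization.Theorems

open Summit.AtomisticToContinuum.Crystallization.Theses.BrittleRungDescent

/-- **Assembly** (route `BrittleRungDescent`; rev-0 item stmt-AtomisticToContinuum-9215, since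
rev 5 item stmt-AtomisticToContinuum-15633):
`LocalHalesKernel → LJBondSpread → LJBarlowRigidity → Crystallization`.
Proof: the proved glue `LJKissingBalls_proof` turns the local-Hales kernel `hG` and the
bond-spread statement `hK` into the hypothesis of `LJBarlowRigidity`, which then yields
`Crystallization`: `hR (LJKissingBalls_proof hG hK)`. [folklore] -/
theorem brittleRungDescent_assembly_proof :
    Summit.AtomisticToContinuum.Crystallization.Theses.BrittleRungDescent.Assembly := by
  unfold Theses.BrittleRungDescent.Assembly
  intro hG hK hR
  exact hR (LJKissingBalls_proof hG hK)

end Summit.AtomisticToContinuum.Crystallization.Theorems
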